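import Literature.Barriers.CriticalPhenomena.LaceExpansionPcSubcrit
import HarnessLib

/-!
# The lace-expansion coefficient at `p_c` is determined by the `x`-space expansion:
# uniqueness of `ℓ¹` solutions of `τ_{p_c} = g + J ⋆ τ_{p_c}` against `IsLaceCoefficientPc`

Barrier catalogue `Literature/Barriers/CriticalPhenomena/` (D-0021), companion of
`LaceExpansionPcInputs.lean` (`IsLaceCoefficientPc d Φ`: the `k`-space conclusions of Hara's
Prop. 1.2 at `p = p_c` — symmetry, `Σ|Π| < ∞`, `Ĵ(0) = 1`, the infrared lower bound and the
Fourier REPRESENTATION `τ_{p_c}(0,x) = ∫ e^{ikx} ĝ(k)/(1 - Ĵ(k)) dk/(2π)^d` — with its uniqueness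
theorem `IsLaceCoefficientPc.unique`) and of `LaceExpansionPcSubcrit.lean` (`IsLaceCoefficientAt d p Φ`:
the `x`-SPACE expansion `τ_p(x) = g(x) + Σ_y J(y) τ_p(x - y)`, `g = δ₀ + Π_p`, `J = 2dp D ⋆ g`,
Heydenreich–van der Hofstad (6.1.2) "valid for `p ≤ p_c`", unique for `p < p_c` by
`IsLaceCoefficientAt.unique`, where `τ_p ∈ ℓ¹`).

At `p = p_c` the two-point function is not summable (`χ(p_c) = ∞`), so the subcritical uniqueness
argument (divide `τ̂ = ĝ + Ĵ τ̂` by `τ̂`) is not available. This file proves the replacement needed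
to identify the Hara–Slade series `Σ_N (-1)^N Π^{(N)}_{p_c}` — which satisfies the `x`-space
expansion at `p_c` (Prop. 6.1 at `p_c` and `M → ∞`, Cor. 8.13) — with THE coefficient `Φ` of
`IsLaceCoefficientPc` (the hypothesis of the `x`-space named facts, e.g.
`HvdH2017_piNDiagramBoundPc`):

* `IsLaceCoefficientPc.eq_of_conv` — if `IsLaceCoefficientPc d Φ` (`d ≥ 1`) and `Ψ ∈ ℓ¹(ℤ^d)`
  satisfies `τ_{p_c}(0,x) = g_Ψ(x) + Σ_y J_Ψ(y) τ_{p_c}(0, x - y)` for all `x`, then `Ψ = Φ`;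
* `IsLaceCoefficientPc.eq_of_isLaceCoefficientAt` — in particular for `IsLaceCoefficientAt d p_c Ψ`.

Proof (Fourier side, with the toolkit of `LaceExpansionPcInputs.lean`): `F = ĝ_Φ/(1 - Ĵ_Φ)` is
integrable on `[-π,π]^d` with coefficients `∫ e^{iky} F = (2π)^d τ_{p_c}(0,y)`
(`IsLaceCoefficientPc.integral_eq`). The general convolution formula
`∫ e^{iky} f̂(k) G(k) dk = Σ_x f(x) ∫ e^{ik(y-x)} G(k) dk` (`integral_cexp_kdot_mul_latticeFT_mul`,
proved here; the tree's annihilation lemma is its special case) turns the `x`-space equation for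
`Ψ` into the vanishing of all Fourier coefficients of `M = (1 - Ĵ_Ψ) F - ĝ_Ψ`; by the annihilation
lemma the same holds for `(1 - Ĵ_Φ) M`, which off `k = 0` equals `ĝ_Φ - ĝ_Ψ` because
`(1 - Ĵ_Φ) F = ĝ_Φ` there (infrared bound) and `Ĵ_• = 2p_c (Σ_j cos k_j) ĝ_•`
(`latticeFT_laceKernel`); Fourier inversion on `ℓ¹(ℤ^d)` gives `g_Φ = g_Ψ`. No symmetry of `Ψ`
is used.

## References

* T. Hara, Ann. Probab. 36 (2008) 530–593: Prop. 1.2 and Appendix A (items 2 and 4: both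
  Fourier relations "hold even at `p = p_c` for `f = Π_{p_c}, g_{p_c}, J_{p_c}`"; the
  representation of `G_{p_c}` as the `p ↑ p_c` limit).
* M. Heydenreich, R. van der Hofstad, *Progress in High-Dimensional Percolation and Random
  Graphs*, Springer 2017: (6.1.2)–(6.1.3) ("valid for `p ≤ p_c`"), Exercise 6.1 (uniqueness
  below `p_c`), Cor. 8.13 ((8.5.1), (8.5.4)–(8.5.5)).
-/

noncomputable section

namespace Literature.Barriers.CriticalPhenomena

open _root_.MeasureTheory _root_.Filter Literature.Probability.LatticeModels
  Literature.Probability.Percolation Literature.Barriers.CriticalPhenomena.Slade2006Prop53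

variable {d : ℕ}

/-! ### The convolution formula for Fourier coefficients on `[-π,π]^d` -/

/-- **Convolution formula**: for `f ∈ ℓ¹(ℤ^d)` and `G` integrable on the cube,
`∫_{[-π,π]^d} e^{ik·y} f̂(k) G(k) dk = Σ_x f(x) ∫_{[-π,π]^d} e^{ik·(y-x)} G(k) dk` (expand
`f̂(k) = Σ_x f(x) e^{-ik·x}` and integrate term by term, dominated by `Σ|f| ∫|G|`). The tree's
annihilation lemma `integral_cexp_kdot_mul_latticeFT_mul_eq_zero` is the case of vanishing
coefficients. [folklore] -/
theorem integral_cexp_kdot_mul_latticeFT_mul {a : Site d → ℝ} (ha : Summable fun x => |a x|)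
    {G : (Fin d → ℝ) → ℂ} (hG : IntegrableOn G (cube d)) (y : Site d) :
    ∫ k in cube d, Complex.exp (Complex.I * (kdot k y : ℂ)) * (latticeFT a k * G k) =
      ∑' x : Site d, (a x : ℂ) *
        ∫ k in cube d, Complex.exp (Complex.I * (kdot k (y - x) : ℂ)) * G k := by
  set μ : Measure (Fin d → ℝ) := volume.restrict (cube d) with hμ
  set F : Site d → (Fin d → ℝ) → ℂ := fun x k =>
    (a x : ℂ) * (Complex.exp (Complex.I * (kdot k (y - x) : ℂ)) * G k) with hF
  have hexp : ∀ k, Complex.exp (Complex.I * (kdot k y : ℂ)) * (latticeFT a k * G k) =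
      ∑' x, F x k := by
    intro k
    unfold latticeFT
    rw [← tsum_mul_right, ← tsum_mul_left]
    refine tsum_congr fun x => ?_
    have hsub : kdot k (y - x) = kdot k y - kdot k x := by
      rw [sub_eq_add_neg, kdot_add, kdot_neg, ← sub_eq_add_neg]
    simp only [hF, hsub]
    have : Complex.exp (Complex.I * ((kdot k y - kdot k x : ℝ) : ℂ)) =
        Complex.exp (Complex.I * (kdot k y : ℂ)) * Complex.exp (-(Complex.I * (kdot k x : ℂ))) := by
      rw [← Complex.exp_add]
      congr 1
      push_cast
      ring
    rw [this]
    ring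
  change ∫ k, Complex.exp (Complex.I * (kdot k y : ℂ)) * (latticeFT a k * G k) ∂μ =
    ∑' x : Site d, (a x : ℂ) * ∫ k, Complex.exp (Complex.I * (kdot k (y - x) : ℂ)) * G k ∂μ
  simp_rw [hexp]
  have hFm : ∀ x, AEStronglyMeasurable (F x) μ := fun x =>
    (((continuous_cexp_I_mul_kdot (y - x)).aestronglyMeasurable).mul hG.aestronglyMeasurable).const_mul _
  have hFnorm : ∀ x k, ‖F x k‖ₑ = ‖a x‖ₑ * ‖G k‖ₑ := by
    intro x k
    rw [← ofReal_norm, ← ofReal_norm, ← ofReal_norm, ← ENNReal.ofReal_mul (norm_nonneg _)]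
    congr 1
    rw [hF]
    dsimp only
    rw [norm_mul, norm_mul, Complex.norm_real, norm_cexp_I_mul_kdot, one_mul, Real.norm_eq_abs]
  have hsum : ∑' x, ∫⁻ k, ‖F x k‖ₑ ∂μ ≠ ⊤ := by
    simp_rw [hFnorm]
    have hx : ∀ x, ∫⁻ k, ‖a x‖ₑ * ‖G k‖ₑ ∂μ = ‖a x‖ₑ * ∫⁻ k, ‖G k‖ₑ ∂μ := fun x =>
      lintegral_const_mul' _ _ enorm_ne_top
    simp_rw [hx]
    rw [ENNReal.tsum_mul_right]
    refine ENNReal.mul_ne_top ?_ hG.hasFiniteIntegral.ne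
    have : ∑' x, ‖a x‖ₑ = ENNReal.ofReal (∑' x, |a x|) := by
      rw [ENNReal.ofReal_tsum_of_nonneg (fun _ => abs_nonneg _) ha]
      refine tsum_congr fun x => ?_
      rw [← ofReal_norm, Real.norm_eq_abs]
    rw [this]
    exact ENNReal.ofReal_ne_top
  rw [integral_tsum hFm hsum]
  refine tsum_congr fun x => ?_
  simp only [hF]
  rw [integral_const_mul]

/-- `f̂` is integrable on the cube for `f ∈ ℓ¹(ℤ^d)` (continuous on the compact cube). [folklore] -/
theorem integrableOn_latticeFT {a : Site d → ℝ} (ha : Summable fun x => |a x|) :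
    IntegrableOn (latticeFT a) (cube d) :=
  (continuous_latticeFT ha).continuousOn.integrableOn_compact
    (isCompact_univ_pi fun _ => isCompact_Icc)

/-! ### Uniqueness at `p_c` from the `x`-space expansion -/

/-- **The coefficient at `p_c` is determined by the `x`-space expansion.** Let
`IsLaceCoefficientPc d Φ` (`d ≥ 1`), and let `Ψ : ℤ^d → ℝ` be absolutely summable with
`τ_{p_c}(0,x) = g_Ψ(x) + Σ_y J_Ψ(y) τ_{p_c}(0, x - y)` for every `x` (`g_Ψ = δ₀ + Ψ`,
`J_Ψ = 2dp_c D ⋆ g_Ψ`; Heydenreich–van der Hofstad (6.1.2) at `p = p_c`). Then `Ψ = Φ`.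
(Multiply the representation's density `F = ĝ_Φ/(1 - Ĵ_Φ)` by `1 - Ĵ_Ψ`: by the `x`-space
equation its Fourier coefficients are those of `ĝ_Ψ`; one annihilation by `1 - Ĵ_Φ` and the
relation `Ĵ = 2p_c(Σ_j cos k_j) ĝ` leave `ĝ_Φ - ĝ_Ψ` with vanishing coefficients.)
[cite: Hara2008, Prop. 1.2 and Appendix A (items 2, 4)]
[cite: HeydenreichVanDerHofstad2017, (6.1.2)–(6.1.3) and Cor. 8.13 ((8.5.1), (8.5.5))] -/
theorem IsLaceCoefficientPc.eq_of_conv (hd : 1 ≤ d) {Φ Ψ : Site d → ℝ}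
    (hΦ : IsLaceCoefficientPc d Φ) (hΨ : Summable fun x => |Ψ x|)
    (hconv : ∀ x : Site d, tau d (criticalProbI d) 0 x =
      laceSource Ψ x + ∑' y, laceKernel (criticalProbI d) Ψ y * tau d (criticalProbI d) 0 (x - y)) :
    Ψ = Φ := by
  set p : ℝ := (criticalProbI d : ℝ) with hp
  set gΦ := laceSource Φ with hgΦ_def
  set gΨ := laceSource Ψ with hgΨ_def
  set JΦ := laceKernel p Φ with hJΦ_def
  set JΨ := laceKernel p Ψ with hJΨ_def
  have hgΦ : Summable fun x => |gΦ x| := summable_abs_laceSource hΦ.summable_abs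
  have hgΨ : Summable fun x => |gΨ x| := summable_abs_laceSource hΨ
  have hJΦ : Summable fun x => |JΦ x| := summable_abs_laceKernel hΦ.summable_abs p
  have hJΨ : Summable fun x => |JΨ x| := summable_abs_laceKernel hΨ p
  have hc : ((2 * Real.pi : ℂ)) ^ d ≠ 0 :=
    pow_ne_zero _ (mul_ne_zero two_ne_zero (Complex.ofReal_ne_zero.2 Real.pi_ne_zero))
  -- the density `F = ĝ_Φ/(1 - Ĵ_Φ)` and its Fourier coefficients `(2π)^d τ_{p_c}(0,y)`
  set F : (Fin d → ℝ) → ℂ := fun k => latticeFT gΦ k / (1 - latticeFT JΦ k) with hF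
  have hiF : IntegrableOn F (cube d) := hΦ.integrableOn_ratio hd
  have hFcoef : ∀ y : Site d, ∫ k in cube d, Complex.exp (Complex.I * (kdot k y : ℂ)) * F k =
      ((2 * Real.pi) ^ d : ℂ) * ((tau d (criticalProbI d) 0 y : ℝ) : ℂ) := by
    intro y
    have e := hΦ.integral_eq y
    simp only [haraIntegrand] at e
    exact e
  -- `M = (1 - Ĵ_Ψ) F - ĝ_Ψ` has vanishing Fourier coefficients
  set M : (Fin d → ℝ) → ℂ := fun k => (F k - latticeFT JΨ k * F k) - latticeFT gΨ k with hM
  have hiM : IntegrableOn M (cube d) :=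
    (hiF.sub (integrableOn_latticeFT_mul hJΨ hiF)).sub (integrableOn_latticeFT hgΨ)
  have hM0 : ∀ y : Site d, ∫ k in cube d, Complex.exp (Complex.I * (kdot k y : ℂ)) * M k = 0 := by
    intro y
    have e : (fun k => Complex.exp (Complex.I * (kdot k y : ℂ)) * M k) = fun k =>
        (Complex.exp (Complex.I * (kdot k y : ℂ)) * F k -
          Complex.exp (Complex.I * (kdot k y : ℂ)) * (latticeFT JΨ k * F k)) -
          Complex.exp (Complex.I * (kdot k y : ℂ)) * latticeFT gΨ k := by
      funext k
      simp only [hM]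
      ring
    have hconvF : ∫ k in cube d, Complex.exp (Complex.I * (kdot k y : ℂ)) * (latticeFT JΨ k * F k) =
        ((2 * Real.pi) ^ d : ℂ) * ((∑' x, JΨ x * tau d (criticalProbI d) 0 (y - x) : ℝ) : ℂ) := by
      rw [integral_cexp_kdot_mul_latticeFT_mul hJΨ hiF y]
      simp_rw [hFcoef]
      rw [Complex.ofReal_tsum]
      push_cast
      rw [← tsum_mul_left]
      refine tsum_congr fun x => ?_
      ring
    have h₁ : IntegrableOn (fun k => Complex.exp (Complex.I * (kdot k y : ℂ)) * F k) (cube d) :=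
      integrableOn_cexp_kdot_mul hiF y
    have h₂ : IntegrableOn (fun k => Complex.exp (Complex.I * (kdot k y : ℂ)) *
        (latticeFT JΨ k * F k)) (cube d) :=
      integrableOn_cexp_kdot_mul (integrableOn_latticeFT_mul hJΨ hiF) y
    have h₁₂ : IntegrableOn (fun k => Complex.exp (Complex.I * (kdot k y : ℂ)) * F k -
        Complex.exp (Complex.I * (kdot k y : ℂ)) * (latticeFT JΨ k * F k)) (cube d) := h₁.sub h₂
    have h₃ : IntegrableOn (fun k => Complex.exp (Complex.I * (kdot k y : ℂ)) * latticeFT gΨ k)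
        (cube d) := integrableOn_cexp_kdot_mul (integrableOn_latticeFT hgΨ) y
    have hI : ∫ k in cube d, Complex.exp (Complex.I * (kdot k y : ℂ)) * M k =
        ((2 * Real.pi) ^ d : ℂ) * ((tau d (criticalProbI d) 0 y -
          (∑' x, JΨ x * tau d (criticalProbI d) 0 (y - x)) - gΨ y : ℝ) : ℂ) := by
      rw [e, integral_sub h₁₂ h₃, integral_sub h₁ h₂, hFcoef y, hconvF,
        integral_cexp_kdot_mul_latticeFT hgΨ y]
      push_cast
      ring
    rw [hI, show tau d (criticalProbI d) 0 y - (∑' x, JΨ x * tau d (criticalProbI d) 0 (y - x)) -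
        gΨ y = 0 by rw [hconv y]; ring]
    simp
  -- one annihilation: `N = (1 - Ĵ_Φ) M`
  set N : (Fin d → ℝ) → ℂ := fun k => (1 - latticeFT JΦ k) * M k with hN
  have hN0 : ∀ y : Site d, ∫ k in cube d, Complex.exp (Complex.I * (kdot k y : ℂ)) * N k = 0 := by
    intro y
    have e : (fun k => Complex.exp (Complex.I * (kdot k y : ℂ)) * N k) = fun k =>
        Complex.exp (Complex.I * (kdot k y : ℂ)) * M k -
          Complex.exp (Complex.I * (kdot k y : ℂ)) * (latticeFT JΦ k * M k) := by
      funext k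
      simp only [hN]
      ring
    rw [e, integral_sub (integrableOn_cexp_kdot_mul hiM y)
      (integrableOn_cexp_kdot_mul (integrableOn_latticeFT_mul hJΦ hiM) y), hM0 y,
      integral_cexp_kdot_mul_latticeFT_mul_eq_zero hJΦ hiM hM0 y, sub_self]
  -- `N = ĝ_Φ - ĝ_Ψ` off the origin
  have hrelΦ : ∀ k, latticeFT JΦ k = ((2 * p * ∑ i, Real.cos (k i) : ℝ) : ℂ) * latticeFT gΦ k :=
    fun k => latticeFT_laceKernel hgΦ p k
  have hrelΨ : ∀ k, latticeFT JΨ k = ((2 * p * ∑ i, Real.cos (k i) : ℝ) : ℂ) * latticeFT gΨ k :=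
    fun k => latticeFT_laceKernel hgΨ p k
  have hNeq : ∀ k ∈ cube d, k ≠ 0 → N k = latticeFT gΦ k - latticeFT gΨ k := by
    intro k hk hk0
    have hu := hΦ.one_sub_latticeFT_ne_zero hd hk hk0
    rw [← hJΦ_def, hrelΦ k] at hu
    simp only [hN, hM, hF, hrelΦ k, hrelΨ k]
    field_simp
    ring
  have hae : ∀ᵐ k ∂(volume.restrict (cube d) : Measure (Fin d → ℝ)), k ∈ cube d ∧ k ≠ 0 := by
    have h1 : ∀ᵐ k ∂(volume.restrict (cube d) : Measure (Fin d → ℝ)), k ∈ cube d :=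
      ae_restrict_mem (measurableSet_cube d)
    have h2 : ∀ᵐ k ∂(volume.restrict (cube d) : Measure (Fin d → ℝ)), k ∈ ({0} : Set (Fin d → ℝ))ᶜ := by
      rw [show (volume.restrict (cube d) : Measure (Fin d → ℝ)) = P d from volume_restrict_cube d]
      exact compl_mem_ae_iff.2 (P_singleton_zero hd)
    filter_upwards [h1, h2] with k hk hk0
    exact ⟨hk, hk0⟩
  -- inversion: `g_Φ = g_Ψ`
  have hgsub : Summable fun x => |gΦ x - gΨ x| :=
    Summable.of_nonneg_of_le (fun _ => abs_nonneg _) (fun x => abs_sub _ _) (hgΦ.add hgΨ)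
  have hgeq : ∀ y : Site d, gΦ y = gΨ y := by
    intro y
    have hinv := integral_cexp_kdot_mul_latticeFT hgsub y
    have hint : ∫ k in cube d, Complex.exp (Complex.I * (kdot k y : ℂ)) *
        latticeFT (fun x => gΦ x - gΨ x) k = 0 := by
      rw [← hN0 y]
      refine integral_congr_ae ?_
      filter_upwards [hae] with k hk
      rw [hNeq k hk.1 hk.2, latticeFT_sub hgΦ hgΨ]
    rw [hint] at hinv
    have h0 : ((gΦ y - gΨ y : ℝ) : ℂ) = 0 := by
      have := hinv.symm
      rwa [mul_eq_zero, or_iff_right hc] at this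
    have h0' : gΦ y - gΨ y = 0 := by exact_mod_cast h0
    linarith
  funext y
  have h := hgeq y
  simp only [hgΦ_def, hgΨ_def, laceSource] at h
  linarith

/-- **In particular**: an `x`-space lace-expansion coefficient at `p = p_c`
(`IsLaceCoefficientAt d (criticalProbI d) Ψ`, Heydenreich–van der Hofstad (6.1.2) at `p_c`) is
the coefficient of `IsLaceCoefficientPc` whenever the latter exists (`d ≥ 1`).
[cite: HeydenreichVanDerHofstad2017, (6.1.2) and Cor. 8.13 ((8.5.1))] -/
theorem IsLaceCoefficientPc.eq_of_isLaceCoefficientAt (hd : 1 ≤ d) {Φ Ψ : Site d → ℝ}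
    (hΦ : IsLaceCoefficientPc d Φ) (hΨ : IsLaceCoefficientAt d (criticalProbI d) Ψ) : Ψ = Φ :=
  hΦ.eq_of_conv hd hΨ.summable_abs hΨ.conv

/-- Hence at most one function has the `x`-space expansion at `p_c` once `IsLaceCoefficientPc`
is inhabited (the `k`-space half `Hara2008_prop12Pc` of Hara's Prop. 1.2 at `p_c`).
[cite: Hara2008, Prop. 1.2 and Appendix A] -/
theorem IsLaceCoefficientAt.unique_criticalProbI (hd : 1 ≤ d) {Φ Ψ₁ Ψ₂ : Site d → ℝ}
    (hΦ : IsLaceCoefficientPc d Φ) (h₁ : IsLaceCoefficientAt d (criticalProbI d) Ψ₁)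
    (h₂ : IsLaceCoefficientAt d (criticalProbI d) Ψ₂) : Ψ₁ = Ψ₂ := by
  rw [hΦ.eq_of_isLaceCoefficientAt hd h₁, hΦ.eq_of_isLaceCoefficientAt hd h₂]

end Literature.Barriers.CriticalPhenomena

end
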